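import Literature.MathematicalPhysics.QuantumFieldTheory.BalabanImbrieJaffe1984to88.BIJ88Sect5StatementsPart2

/-!
# `BalabanImbrieJaffe1984to88.BIJ88W4Combined5111` — T. Bałaban, J. Imbrie, A. Jaffe, *Effective action and cluster properties of the
abelian Higgs model*, Commun. Math. Phys. **114** (1988) 257–315 [BalabanImbrieJaffe1988]: Sect. 5.11 *Mayer Expansion I*, p. 299
[PDF 43], the two sentences around **(5.11.1)**:

(A) *"Let us combine the irrelevant terms as follows: ⟨f, w₃A^{(k)}⟩ + ½⟨f, w₄f⟩ + ⟨φ^{(k)}, w₆ψ⟩ + ½⟨ψ, w₇ψ⟩ + Σ_□ W₁^{(k)}(□) +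
Σ_X W₂^{(k)}(X) + Σ_□ W₃^{(k)}(□) = Σ_X W₄^{(k)}(X), with W₄^{(k)}(X) containing terms with dependence in X. We combine the estimates
on the above terms to obtain |W₄^{(k)}(X)| ≤ [e^β(L^kε/ε₀)^{1/4−α}]^{n̄+1} e^{−cr(e_k)|X|^−} + Σ_{j<k} e_j^{1−α} e^{−cr(e_k)|X|}
|B_{k−j−1}(X) ∩ Λ₅^{(j)′} ∩ Λ₆^{(j+1)c}|"* — PROVED as a KNITTING (`ineqW4_knit`, `ineqW4_combined`): from the piece bounds
(5.6.13) `Ineq5613` (|W₁(□)| ≤ e_k^{n̄−1−α}), p. 298 `IneqW3` (|W₃(□)| ≤ θ^{n̄+1}, θ the vertex factor), (5.7.14) `Ineq5714` (the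
W₂ bound) and a bound `K_f e^{−cr(e_k)|X|^−}` for the part of W₄ collecting the four field–kernel terms, the triangle inequality
gives r16's typed combined bound `IneqW4 … K n̄` for every constant `K` with `K^{n̄+1} ≥ K_f + e_k^{n̄−1−α} + θ^{n̄+1} + e_k^κ`; the
paper prints `K = θ` (*"(We allow adjustments in β, α, β′, keeping them small.)"*, p. 310) — when each of the three small
quantities is `≤ θ^{n̄+1}` one may take `K = 4^{1/(n̄+1)}θ` (`knit_constant_le`), and in the charge reading `θ = e^β s^{1/4−α}`
this is EXACTLY an adjustment of β: `4^{1/(n̄+1)}e^β = e^{β′}`, `β′ = β − log 4/((n̄+1)log e⁻¹) < β` (`charge_adjust`,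
`charge_adjust_lt`).

(B) *"We can only Mayer-expand small terms, therefore we parcel up W₄^{(k)}(X) into manageable chunks. It is a simple matter to
decompose W₄^{(k)}(X) as follows W₄^{(k)}(X) = Σ_{j<k} Σ_{x_j ∈ B_{k−j−1}(X)∩Λ₅^{(j)′}∩Λ₆^{(j+1)c}} W_{4,j}^{(k)}(x_j, X) + W_{4,k}^{(k)}(x_k, X).
Here x_k is some distinguished point in X (for unity of notation) and |W_{4,j}^{(k)}(x_j, X)| ≤ e_j^{1−α}e^{−cr(e_k)|X|},
|W_{4,k}^{(k)}(x_k, X)| ≤ [e^β(L^kε/ε₀)]^{n̄+1}e^{−cr(e_k)|X|^−}. (5.11.1)"* — PROVED (`exists_decomposition_5111`): the combined bound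
`IneqW4` alone yields such a decomposition with r16's leaf `Ineq5111` INHABITED, by proportional splitting of W₄^{(k)}(X) among the
summands of its bound; together with r16's converse `BIJ88Sect5StatementsPart2.ineqW4_of_5111` this is an equivalence
(`ineqW4_iff_exists_5111`).

statement-level skeleton of published theorems with citation tags; proofs where landed; nothing here is a claim about the Yang–Mills mass gap

PDF held: `paper:balaban1988-cmp114-bij-abelian-higgs-effective-action` (journal page = PDF page + 256).  Page read as image: PDF p. 43
(journal 299), `g4png.py` ×2 render (seat folder `renders/original-p043-x2.png`).

CITATION HEADER (lean-in-tree rule).  Part of the lit-balaban TYPED SKELETON (HOME `run/shared/lean/pub/lit-balaban/`), Phase 2,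
seat p36 (gen 5, unit `lit-balaban-p36`); row **C2.Eq5.11.1** of `HOME/lit-balaban-r16/ROWS-C2-part2.md` (typed p240155: leaves
`Ineq5111`, `IneqW4` + bookkeeping `ineqW4_of_5111` proved by r16).  Carriers: r16's schematic `PolymerSys` (polymers X with the
cube count |X|, |X|^− = max{0,|X|−1}), the single cubes □ entering through a map `cube : Cube → P.Poly` onto polymers of count 1,
the large-field point sets `pts j X` ⊆ `Pt` with `lfVol j X = (pts j X).card` exactly as in `ineqW4_of_5111`.  MODEL READING (stated
as such): the regrouping "W₄^{(k)}(X) containing terms with dependence in X" is taken as a decomposition `W₄ = W_f + W₁₃ + W₂` into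
the field–kernel part, the single-cube part (W₁ + W₃ on |X| = 1, zero otherwise) and W₂, each with its printed bound; the kernel
part's bound `K_f e^{−cr(e_k)|X|^−}` is a hypothesis (its derivation from (5.4.7)/(5.5.5)/(5.9.x) is the polymer geometry of
(5.7.6), not repeated here).  Theorems only; no definitions, no `Prop` facts; axioms standard.
-/

namespace Literature.MathematicalPhysics.QuantumFieldTheory.BalabanImbrieJaffe1984to88.BIJ88W4Combined5111

open Literature.MathematicalPhysics.QuantumFieldTheory.BalabanImbrieJaffe1984to88.BIJ88Sect5StatementsPart2

variable {P : PolymerSys}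

/-! ## §1 The single-cube terms `W₁^{(k)}(□) + W₃^{(k)}(□)` as a polymer activity -/

/-- The single-cube part of W₄: `W₁₃(cube □) = W₁(□) + W₃(□)` and `W₁₃(X) = 0` off the one-cube polymers; with (5.6.13) `Ineq5613`
and p. 298 `IneqW3` it obeys `|W₁₃(X)| ≤ (e_k^{n̄−1−α} + θ^{n̄+1})·e^{−cr(e_k)|X|^−}` (on a single cube |X|^− = 0).
[cite: BalabanImbrieJaffe1988, (5.11.1) p.299] -/
theorem singleCube_bound {Cube : Type} (cube : Cube → P.Poly) (hcard : ∀ q, P.card (cube q) = 1) {W₁ W₃ : Cube → ℝ}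
    {W₁₃ : P.Poly → ℝ} (hon : ∀ q, W₁₃ (cube q) = W₁ q + W₃ q) (hoff : ∀ X, (∀ q, cube q ≠ X) → W₁₃ X = 0)
    {ek θ α : ℝ} {nbar : ℕ} (h1 : Ineq5613 Cube W₁ ek nbar α) (h3 : IneqW3 Cube W₃ θ nbar) (hek : 0 ≤ ek) (hθ : 0 ≤ θ)
    (c rk : ℝ) (X : P.Poly) :
    |W₁₃ X| ≤ (ek ^ ((nbar : ℝ) - 1 - α) + θ ^ (nbar + 1)) * Real.exp (-(c * rk) * P.cardMinus X) := by
  by_cases hX : ∃ q, cube q = X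
  · obtain ⟨q, rfl⟩ := hX
    have hcm : (P.cardMinus (cube q) : ℝ) = 0 := by
      simp [PolymerSys.cardMinus, hcard q]
    rw [hon q, hcm, mul_zero, Real.exp_zero, mul_one]
    exact (abs_add_le _ _).trans (add_le_add (h1 q) (h3 q))
  · have hX' : ∀ q, cube q ≠ X := fun q hq => hX ⟨q, hq⟩
    rw [hoff X hX', abs_zero]
    positivity

/-! ## §2 (A) The combined bound as a knitting of the piece bounds -/

/-- **The combined W₄ bound, abstract knitting.**  If `W₄ = W_f + W₁₃ + W₂` with `|W_f(X)| ≤ K_f e^{−cr(e_k)|X|^−}`,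
`|W₁₃(X)| ≤ B₁₃ e^{−cr(e_k)|X|^−}`, W₂ obeying (5.7.14) `Ineq5714` (first constant e_k^κ), and `K_f + B₁₃ + e_k^κ ≤ K^{n̄+1}`, then W₄
obeys the printed combined bound `IneqW4 … K n̄`. [cite: BalabanImbrieJaffe1988, (5.11.1) p.299] -/
theorem ineqW4_knit {k : ℕ} {W₄ Wf W₁₃ W₂ : P.Poly → ℝ} {e : ℕ → ℝ} {lfVol : ℕ → P.Poly → ℕ}
    {α c rk K κ Kf B₁₃ : ℝ} {nbar : ℕ} (hdec : ∀ X, W₄ X = Wf X + W₁₃ X + W₂ X)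
    (hWf : ∀ X, |Wf X| ≤ Kf * Real.exp (-(c * rk) * P.cardMinus X))
    (h13 : ∀ X, |W₁₃ X| ≤ B₁₃ * Real.exp (-(c * rk) * P.cardMinus X))
    (h2 : Ineq5714 P W₂ k e lfVol κ α c rk) (hK : Kf + B₁₃ + e k ^ κ ≤ K ^ (nbar + 1)) :
    IneqW4 P k W₄ e lfVol α c rk K nbar := by
  intro X
  have hE : 0 < Real.exp (-(c * rk) * P.cardMinus X) := Real.exp_pos _
  rw [hdec X]
  calc |Wf X + W₁₃ X + W₂ X|
      ≤ |Wf X| + |W₁₃ X| + |W₂ X| := abs_add_three _ _ _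
    _ ≤ Kf * Real.exp (-(c * rk) * P.cardMinus X) + B₁₃ * Real.exp (-(c * rk) * P.cardMinus X)
        + (e k ^ κ * Real.exp (-(c * rk) * P.cardMinus X)
          + ∑ j ∈ Finset.range k, e j ^ (1 - α) * Real.exp (-(c * rk) * P.card X) * lfVol j X) :=
        add_le_add (add_le_add (hWf X) (h13 X)) (h2 X)
    _ = (Kf + B₁₃ + e k ^ κ) * Real.exp (-(c * rk) * P.cardMinus X)
        + ∑ j ∈ Finset.range k, e j ^ (1 - α) * Real.exp (-(c * rk) * P.card X) * lfVol j X := by ring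
    _ ≤ K ^ (nbar + 1) * Real.exp (-(c * rk) * P.cardMinus X)
        + ∑ j ∈ Finset.range k, e j ^ (1 - α) * Real.exp (-(c * rk) * P.card X) * lfVol j X :=
        add_le_add (mul_le_mul_of_nonneg_right hK hE.le) le_rfl

/-- **p. 299, "We combine the estimates on the above terms to obtain" the combined W₄ bound** — the printed instance of the
knitting: pieces `W₄ = W_f + W₁₃ + W₂`, `W₁₃` the single-cube activity of `W₁ + W₃` (`singleCube_bound`), with (5.6.13) `Ineq5613`
(e_k = `e k`), p. 298 `IneqW3` (vertex factor θ ≥ 0), (5.7.14) `Ineq5714`, the kernel part bounded by `K_f e^{−cr(e_k)|X|^−}`, and any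
constant `K` with `K_f + (e_k^{n̄−1−α} + θ^{n̄+1}) + e_k^κ ≤ K^{n̄+1}` (the print's `K = θ` after *"adjustments in β, α"*, cf.
`knit_constant_le`, `charge_adjust`). [cite: BalabanImbrieJaffe1988, (5.11.1) p.299] -/
theorem ineqW4_combined {Cube : Type} (cube : Cube → P.Poly) (hcard : ∀ q, P.card (cube q) = 1) {k : ℕ}
    {W₄ Wf W₁₃ W₂ : P.Poly → ℝ} {W₁ W₃ : Cube → ℝ} {e : ℕ → ℝ} {lfVol : ℕ → P.Poly → ℕ} {α c rk K κ Kf θ : ℝ} {nbar : ℕ}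
    (hdec : ∀ X, W₄ X = Wf X + W₁₃ X + W₂ X) (hWf : ∀ X, |Wf X| ≤ Kf * Real.exp (-(c * rk) * P.cardMinus X))
    (hon : ∀ q, W₁₃ (cube q) = W₁ q + W₃ q) (hoff : ∀ X, (∀ q, cube q ≠ X) → W₁₃ X = 0)
    (h1 : Ineq5613 Cube W₁ (e k) nbar α) (h3 : IneqW3 Cube W₃ θ nbar) (h2 : Ineq5714 P W₂ k e lfVol κ α c rk)
    (hek : 0 ≤ e k) (hθ : 0 ≤ θ) (hK : Kf + (e k ^ ((nbar : ℝ) - 1 - α) + θ ^ (nbar + 1)) + e k ^ κ ≤ K ^ (nbar + 1)) :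
    IneqW4 P k W₄ e lfVol α c rk K nbar :=
  ineqW4_knit hdec hWf (singleCube_bound cube hcard hon hoff h1 h3 hek hθ c rk) h2 hK

/-! ## §3 The constant: "(We allow adjustments in β, α, β′, keeping them small.)" -/

/-- If each of the three small quantities is at most θ^{n̄+1}, the knitting constant may be taken `K = 4^{1/(n̄+1)}·θ`:
`x + (y + θ^{n̄+1}) + z ≤ (4^{1/(n̄+1)}θ)^{n̄+1} = 4θ^{n̄+1}`. [cite: BalabanImbrieJaffe1988, (5.11.1) p.299] -/
theorem knit_constant_le {θ x y z : ℝ} {nbar : ℕ} (hx : x ≤ θ ^ (nbar + 1)) (hy : y ≤ θ ^ (nbar + 1))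
    (hz : z ≤ θ ^ (nbar + 1)) :
    x + (y + θ ^ (nbar + 1)) + z ≤ ((4 : ℝ) ^ ((1 : ℝ) / (nbar + 1)) * θ) ^ (nbar + 1) := by
  have h4 : ((4 : ℝ) ^ ((1 : ℝ) / (nbar + 1))) ^ (nbar + 1) = 4 := by
    rw [← Real.rpow_natCast, ← Real.rpow_mul (by norm_num)]
    have : (1 : ℝ) / (nbar + 1) * ((nbar + 1 : ℕ) : ℝ) = 1 := by
      push_cast
      field_simp
    rw [this, Real.rpow_one]
  rw [mul_pow, h4]
  linarith

/-- **The adjustment in β made exact** (charge reading of e^β, 0 < e < 1): `4^{1/(n̄+1)}·e^β = e^{β′}` with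
`β′ = β − log 4/((n̄+1)·log e⁻¹)`. [cite: BalabanImbrieJaffe1988, (5.11.1) p.299] -/
theorem charge_adjust {e : ℝ} (β : ℝ) (nbar : ℕ) (he0 : 0 < e) (he1 : e < 1) :
    (4 : ℝ) ^ ((1 : ℝ) / (nbar + 1)) * e ^ β = e ^ (β - Real.log 4 / ((nbar + 1) * Real.log e⁻¹)) := by
  have hlog : Real.log e < 0 := Real.log_neg he0 he1
  have hlog' : Real.log e ≠ 0 := hlog.ne
  rw [Real.log_inv, Real.rpow_sub he0, Real.rpow_def_of_pos he0 (Real.log 4 / _), Real.rpow_def_of_pos (by norm_num : (0:ℝ) < 4)]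
  have hexp : Real.log e * (Real.log 4 / ((nbar + 1) * -Real.log e)) = -(Real.log 4 * (1 / (nbar + 1))) := by
    field_simp
  rw [hexp, Real.exp_neg, div_inv_eq_mul, mul_comm]

/-- … and `β′ < β` (the adjustment LOWERS the power of the small charge: log 4 > 0, log e⁻¹ > 0).
[cite: BalabanImbrieJaffe1988, (5.11.1) p.299] -/
theorem charge_adjust_lt {e : ℝ} (β : ℝ) (nbar : ℕ) (he0 : 0 < e) (he1 : e < 1) :
    β - Real.log 4 / ((nbar + 1) * Real.log e⁻¹) < β := by
  have hlog : 0 < Real.log e⁻¹ := by rw [Real.log_inv]; have := Real.log_neg he0 he1; linarith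
  exact sub_lt_self _ (div_pos (Real.log_pos (by norm_num)) (mul_pos (by positivity) hlog))

/-! ## §4 (B) "It is a simple matter to decompose W₄^{(k)}(X) as follows": (5.11.1) from the combined bound -/

/-- Proportional splitting: for `0 ≤ a`, `0 ≤ T` and `|w| ≤ T`, the share `w·a/T` is bounded by `a` (Lean's `x/0 = 0` covers `T = 0`).
[cite: BalabanImbrieJaffe1988, (5.11.1) p.299] -/
theorem abs_mul_div_le {w a T : ℝ} (ha : 0 ≤ a) (hT : 0 ≤ T) (hw : |w| ≤ T) : |w * a / T| ≤ a := by
  rcases hT.eq_or_lt with h | h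
  · rw [← h, div_zero, abs_zero]; exact ha
  · rw [abs_div, abs_mul, abs_of_nonneg ha, abs_of_pos h, div_le_iff₀ h]
    calc |w| * a ≤ T * a := mul_le_mul_of_nonneg_right hw ha
      _ = a * T := mul_comm _ _

/-- **(5.11.1) from the combined bound.**  If W₄ obeys `IneqW4 … K n̄` with `lfVol j X = |pts j X|` (K ≥ 0, e_j ≥ 0), then splitting
W₄(X) proportionally to the summands of its bound — `W_{4,k}(x_k,X) = W₄(X)·K^{n̄+1}e^{−cr|X|^−}/T(X)`, `W_{4,j}(x_j,X) =
W₄(X)·e_j^{1−α}e^{−cr|X|}/T(X)` for each point `x_j ∈ pts j X`, `T(X)` the total bound — gives the printed decomposition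
`W₄(X) = Σ_{j<k} Σ_{x_j} W_{4,j}(x_j,X) + W_{4,k}(x_k,X)` with the bounds (5.11.1), i.e. r16's leaf `Ineq5111` inhabited.
[cite: BalabanImbrieJaffe1988, (5.11.1) p.299] -/
theorem exists_decomposition_5111 {Pt : Type} (k : ℕ) (W₄ : P.Poly → ℝ) (e : ℕ → ℝ) (pts : ℕ → P.Poly → Finset Pt)
    {α c rk K : ℝ} (nbar : ℕ) (hK : 0 ≤ K) (he : ∀ j, 0 ≤ e j)
    (h : IneqW4 P k W₄ e (fun j X => (pts j X).card) α c rk K nbar) :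
    ∃ (W₄ⱼ : ℕ → Pt → P.Poly → ℝ) (W₄ₖ : P.Poly → ℝ),
      (∀ X, W₄ X = (∑ j ∈ Finset.range k, ∑ x ∈ pts j X, W₄ⱼ j x X) + W₄ₖ X) ∧
        Ineq5111 P Pt k W₄ⱼ W₄ₖ e α c rk K nbar := by
  -- the summands of the combined bound and their total
  set a : P.Poly → ℝ := fun X => K ^ (nbar + 1) * Real.exp (-(c * rk) * P.cardMinus X) with ha
  set b : ℕ → P.Poly → ℝ := fun j X => e j ^ (1 - α) * Real.exp (-(c * rk) * P.card X) with hb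
  set T : P.Poly → ℝ := fun X => a X + ∑ j ∈ Finset.range k, b j X * ((pts j X).card : ℕ) with hT
  have ha0 : ∀ X, 0 ≤ a X := fun X => mul_nonneg (pow_nonneg hK _) (Real.exp_pos _).le
  have hb0 : ∀ j X, 0 ≤ b j X := fun j X => mul_nonneg (Real.rpow_nonneg (he j) _) (Real.exp_pos _).le
  have hWT : ∀ X, |W₄ X| ≤ T X := fun X => by
    have := h X
    simp only [hT, ha, hb]
    linarith
  have hT0 : ∀ X, 0 ≤ T X := fun X => (abs_nonneg _).trans (hWT X)
  refine ⟨fun j _ X => W₄ X * b j X / T X, fun X => W₄ X * a X / T X, ?_, ?_, ?_⟩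
  · -- the decomposition identity
    intro X
    simp only [Finset.sum_const, nsmul_eq_mul]
    rcases (hT0 X).eq_or_lt with h0 | hpos
    · have hW : W₄ X = 0 := abs_eq_zero.mp (le_antisymm (h0 ▸ hWT X) (abs_nonneg _))
      simp [hW]
    · have hTne : T X ≠ 0 := hpos.ne'
      have hsum : ∑ j ∈ Finset.range k, ((pts j X).card : ℝ) * (W₄ X * b j X / T X)
          = W₄ X * (∑ j ∈ Finset.range k, b j X * ((pts j X).card : ℕ)) / T X := by
        rw [Finset.mul_sum, Finset.sum_div]
        exact Finset.sum_congr rfl fun j _ => by ring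
      rw [hsum]
      field_simp
      simp only [hT]
      ring
  · -- (5.11.1), the j < k pieces
    intro j _ x X
    exact abs_mul_div_le (hb0 j X) (hT0 X) (hWT X)
  · -- (5.11.1), the j = k piece
    intro X
    exact abs_mul_div_le (ha0 X) (hT0 X) (hWT X)

/-- **The combined bound ⟺ (5.11.1) with the printed decomposition** (K ≥ 0, e_j ≥ 0): `exists_decomposition_5111` and r16's
`ineqW4_of_5111`. [cite: BalabanImbrieJaffe1988, (5.11.1) p.299] -/
theorem ineqW4_iff_exists_5111 {Pt : Type} (k : ℕ) (W₄ : P.Poly → ℝ) (e : ℕ → ℝ) (pts : ℕ → P.Poly → Finset Pt)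
    {α c rk K : ℝ} (nbar : ℕ) (hK : 0 ≤ K) (he : ∀ j, 0 ≤ e j) :
    IneqW4 P k W₄ e (fun j X => (pts j X).card) α c rk K nbar ↔
      ∃ (W₄ⱼ : ℕ → Pt → P.Poly → ℝ) (W₄ₖ : P.Poly → ℝ),
        (∀ X, W₄ X = (∑ j ∈ Finset.range k, ∑ x ∈ pts j X, W₄ⱼ j x X) + W₄ₖ X) ∧
          Ineq5111 P Pt k W₄ⱼ W₄ₖ e α c rk K nbar :=
  ⟨exists_decomposition_5111 k W₄ e pts nbar hK he,
    fun ⟨W₄ⱼ, W₄ₖ, hdec, h5111⟩ => ineqW4_of_5111 P Pt k W₄ⱼ W₄ₖ W₄ e pts α c rk K nbar hdec h5111⟩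

end Literature.MathematicalPhysics.QuantumFieldTheory.BalabanImbrieJaffe1984to88.BIJ88W4Combined5111
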